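import Summits.BirchSwinnertonDyer.BirchSwinnertonDyer.Theorems.ThetaPartnerAtTwoKatoZetaErlKSideCMAtTwoSupplyOfDisplayedHondaCharValues
import Summits.BirchSwinnertonDyer.BirchSwinnertonDyer.Theorems.ThetaPartnerAtTwoSignedKatoUpToAtTwoCoreOfPrimitiveCharValues
import HarnessLib

/-!
# Route `ThetaPartnerAtTwo` (TP2), K2 column — C1 `KatoZetaErlKSideCMAtTwoSupply` (stmt-BirchSwinnertonDyer-28306, HOLD) from its print
# core on the displayed Honda system, character-value currency, PRIMITIVE CHARACTERS (and the levels `n ≤ 1`) SUFFICE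

Seat `bsd-input-kz-cm-two` g0 (literature-prover, cell `pub/bsd-wall/bsd-inputs`). Third file of the series
`…KatoZetaErlKSideCMAtTwoSupplyOfDisplayedHonda` (C1 ⟸ (ERL_pair) ∧ K-side datum on the displayed data) /
`…OfDisplayedHondaCharValues` (C1 ⟸ (ERL_pairχ) ∧ K-side datum). HONEST FRAMING: one theorem, an implication displaying its hypothesis;
no definition, no named fact, no instance, no `sorry`; item 28306 is NOT closed; no summit statement (BSD) is proved by this file.

## What is here

`katoZetaErlKSideCMAtTwoSupply_of_primCharValuesKSideOnDisplayedHonda : hXχ^prim → C1`, where `hXχ^prim` is `hXχ` with the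
character-value identity «`ν(χ(γ)−1)·χ(P_{n,d_n}(pair n (I.proj n s))) = μ(χ(γ)−1)·ratTwistedSymbolSum f χ`» required ONLY for PRIMITIVE
`χ` (conductor `2^{n+2}`) and for the levels `n ≤ 1` — exactly the output currency of the K3 socket
`KatoBK.corePairChiPrim_of_coreKZ_of_bricks` (so that the future `γ`-type socket for the CM form targets this hypothesis). The passage
prim ⟹ all is the K3 lineage's strong induction (`CoreChi.corePairChi_of_corePairChiPrim`, CM-blind, re-run here on the CM habitat
because the K3 statement threads `¬ W.HasCM`): the two distribution relations at `a₂ = 0` — `CoreChi.eval₂_mazurTateElement_add_two_eq`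
(`θ_{m+2}(ζ−1) = −Φ_{2^{m+1}}(ζ)·θ_m(ζ−1)`, Mazur–Tate–Teitelbaum §I.10 (10.2)) and `CoreChi.sum_evalOn_pow_smul_add_two_eq_of_mem` (the
P-side relation from (TR) `Tr_{m+2/m+1} d_{m+2} = −d_m` on the LAYER functional `pair (m+2) (I.proj (m+2) s)`), the passage from the
level-`(m+2)` functional to the level-`m` functional on the orbit of `d_m` being (P1) + `I.cores_proj`, twice.

References: [MazurTateTeitelbaum1986Invent] §I.10 (10.2), §I.13; [Kobayashi2003] Def. 1.1, (8.23) (p. 18), proof of Thm. 6.3 (p. 25);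
[Kato2004Asterisque] §12.2 (p. 220), Thm. 12.5 (1) (p. 221), (15.16.1) (p. 265); [Sprung2012] Def. 3.1; [JohnsonLeungKings2011] Thm. 5.7, §7.2.
-/

set_option autoImplicit false
-- the Theorems namespace of this sub repeats the summit name by design (D-0017 nested layout)
set_option linter.dupNamespace false

noncomputable section

open scoped Classical NumberField MatrixGroups ModularForm

open NumberField IsDedekindDomain CongruenceSubgroup WeierstrassCurve Field Polynomial Literature Literature.NumberTheory.EllipticCurves
  Literature.NumberTheory.GaloisRepresentations Literature.NumberTheory.EllipticCurves.ModularForms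
  Literature.NumberTheory.EllipticCurves.Rank1Residual Literature.NumberTheory.EllipticCurves.IwasawaDual
  Literature.NumberTheory.EllipticCurves.Kobayashi2003 Literature.NumberTheory.EllipticCurves.Module
  Literature.NumberTheory.EllipticCurves.Kato2004 Literature.NumberTheory.EllipticCurves.Kato2004.EulerSystemValues
  Literature.NumberTheory.EllipticCurves.GreenbergSelmer Literature.NumberTheory.EllipticCurves.Sprung2012
  Literature.NumberTheory.EllipticCurves.FormalGroupChart
  ZpExtension Summit.BirchSwinnertonDyer.Rank1Residual.Supersingular
  Summit.BirchSwinnertonDyer.Rank1Residual.Additive Summit.BirchSwinnertonDyer.Rank1Residual.Additive.PadicCyclotomicTower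
  Summit.BirchSwinnertonDyer.Rank1Residual.Additive.BallEval Summit.BirchSwinnertonDyer.Rank1Residual.Additive.LocalTransport
  Summit.BirchSwinnertonDyer.BirchSwinnertonDyer.Theorems.SignedKatoOffTwo
  Summit.BirchSwinnertonDyer.BirchSwinnertonDyer.Theorems.SignedKatoOffTwo.LocalTwo

namespace Summit.BirchSwinnertonDyer.BirchSwinnertonDyer.Theorems.KatoZetaErlKSideCMAtTwo

open Rat.HeightOneSpectrum

set_option maxHeartbeats 800000 in
/-- **C1 BY NAME ⟸ its print core on the displayed Honda system, PRIMITIVE-CHARACTER-VALUE FORM.** As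
`katoZetaErlKSideCMAtTwoSupply_of_charValuesKSideOnDisplayedHonda`, but the identity
`ν(χ(5)−1)·χ(P_{n,d_n}(pair n (I.proj n s))) = μ(χ(5)−1)·ratTwistedSymbolSum f χ` is asked only for `χ` PRIMITIVE mod `2^{n+2}` or `n ≤ 1`;
the imprimitive characters follow by strong induction on `n` from the distribution relations at `a₂ = 0` on both sides ((TR) + (P1) +
norm compatibility of `s` on the P-side, the three-term relation of the Mazur–Tate elements on the θ-side). CONDITIONAL on `hXχ^prim`
(published input: Kato Thm. 12.5 (1) + (15.16.1) for `f_A` read on the layer pairing through Bloch–Kato / Kobayashi (8.23), Prop. 8.25–8.26;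
Kato §15 / JLK Thm. 5.7 §7.2 for the datum); closes nothing by itself; BSD is not proved by this.
[cite: Kato2004Asterisque, §12.2 (p. 220), Thm. 12.5 (1) (p. 221), (15.16.1) (p. 265)] [cite: Kobayashi2003, Def. 1.1, (8.23) (p. 18), proof of Thm. 6.3 (p. 25)]
[cite: MazurTateTeitelbaum1986Invent, §I.10 (10.2), §I.13] [cite: JohnsonLeungKings2011, Thm. 5.7 and §7.2] -/
theorem katoZetaErlKSideCMAtTwoSupply_of_primCharValuesKSideOnDisplayedHonda
    (hXχp :
      ∀ (v : HeightOneSpectrum (𝓞 ℚ)), ((2 : ℕ) : 𝓞 ℚ) ∈ v.asIdeal →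
      ∀ (A : WeierstrassCurve ℚ) [A.IsElliptic] [A.IsGloballyMinimal],
        A.HasCM → A.analyticRank = 0 → GoodSS A 2 → A.frobeniusTrace 2 = 0 →
        2 ∣ A.shaOrder * A.tamagawaProduct →
        ∀ (κ : ZpExtension ℚ 2) (γ : Field.absoluteGaloisGroup ℚ),
          κ.IsCyclotomic → κ.IsTopGenerator γ → IsCyclotomicVariable 2 γ →
        ∀ [NeZero (A.conductorNorm ℤ)] (f : CuspForm (Gamma0 (A.conductorNorm ℤ)) 2),
          IsNewformOf A f → ∀ (ϖ : ℚ), (ϖ : ℝ) * A.realPeriodRat = plusPeriod f →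
        ∀ (Lplus Lminus : IwasawaAlgebra 2), IsPollackPair f 2 Lplus Lminus →
        ∀ [ContinuousSMul ℤ_[2] (A.tateModule 2)] (Y : A.FineSelmerDualData κ γ),
        ∀ 𝔭' : PrimeSpectrum (IwasawaAlgebra 2), 𝔭'.asIdeal.height = 1 →
          PowerSeries.C (2 : ℤ_[2]) ∉ 𝔭'.asIdeal →
        ∀ (I : Kato2004.IwasawaH1Data A 2 κ γ)
          (pair : ∀ n : ℕ, H1 (tateRep A 2) (κ.layerSubgroup n) →ₗ[ℤ_[2]]
            (localLayerPointsOfEmb κ (closureEmb (K := ℚ) (v.adicCompletion ℚ)) A n →+ ℤ_[2])),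
          (∀ (n : ℕ) (x : H1 (tateRep A 2) (κ.layerSubgroup (n + 1))) (Q : localPoints A (v.adicCompletion ℚ))
            (hQ : Q ∈ localLayerPointsOfEmb κ (closureEmb (K := ℚ) (v.adicCompletion ℚ)) A n),
            pair n (layerCores (tateRep A 2) κ n x) ⟨Q, hQ⟩ =
              pair (n + 1) x ⟨Q, localLayerPointsOfEmb_mono κ (closureEmb (K := ℚ) (v.adicCompletion ℚ)) A (Nat.le_succ n) hQ⟩) →
          (∀ (n : ℕ) (g : Field.absoluteGaloisGroup (v.adicCompletion ℚ)) (y : H1 (tateRep A 2) (κ.layerSubgroup n))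
            (Q : localPoints A (v.adicCompletion ℚ))
            (hQ : Q ∈ localLayerPointsOfEmb κ (closureEmb (K := ℚ) (v.adicCompletion ℚ)) A n),
            pair n (conjMap (tateRep A 2).toTopRep (κ.layerSubgroup n) (resGalOfEmb (closureEmb (K := ℚ) (v.adicCompletion ℚ)) g) 1 y)
              ⟨g • Q, smul_mem_localLayerPointsOfEmb κ (closureEmb (K := ℚ) (v.adicCompletion ℚ)) A n g hQ⟩ = pair n y ⟨Q, hQ⟩) →
          (∀ (n k : ℕ) (x : H1 (tateRep A 2) (κ.layerSubgroup n))
            (Q : localLayerPointsOfEmb κ (closureEmb (K := ℚ) (v.adicCompletion ℚ)) A n),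
            PadicInt.toZModPow k (pair n x Q) =
              LayerPairing.layerPairingPk A κ v (LayerPairing.weilTowerPk A) (LayerPairing.weilTowerPk_pow A)
                (LayerPairing.weilTowerPk_add_left A) (LayerPairing.weilTowerPk_add_right A) (LayerPairing.weilTowerPk_smul A)
                n k x Q) →
        ∀ (Φ : AlgebraicClosure ℚ_[2] ≃ₐ[ℚ] AlgebraicClosure (v.adicCompletion ℚ)) (φ : ℚ_[2] ≃+* v.adicCompletion ℚ)
          (hΦφ : ∀ y : ℚ_[2], Φ (algebraMap ℚ_[2] (AlgebraicClosure ℚ_[2]) y) =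
            algebraMap (v.adicCompletion ℚ) (AlgebraicClosure (v.adicCompletion ℚ)) (φ y))
          (ι : AlgebraicClosure ℚ →ₐ[ℚ] AlgebraicClosure ℚ_[2]),
          (∀ z, closureEmb (K := ℚ) (v.adicCompletion ℚ) z = Φ (ι z)) →
        ∀ (c : ℕ → localPoints A ℚ_[2]) (σ : ℕ → Field.absoluteGaloisGroup ℚ_[2]) (d₀ : ℕ → localPoints A ℚ_[2])
          (d : ℕ → localPoints A (v.adicCompletion ℚ)),
          (haveI := isIntegral_genFib_baseChange 2 ((integralModelInt A).map (Int.castRingHom ℤ_[2]))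
            ∀ m, (toLoc ((genFibΩ_eq_baseChange ((integralModelInt A).map (Int.castRingHom ℤ_[2]))).trans
                  (baseChange_twoAdicModel A))).symm (c m) ∈
                subfieldPoints (genFibΩ 2 ((integralModelInt A).map (Int.castRingHom ℤ_[2]))) (layer 2 m).toSubfield
                  coeffs_mem_layer ∧
              (toLoc ((genFibΩ_eq_baseChange ((integralModelInt A).map (Int.castRingHom ℤ_[2]))).trans
                  (baseChange_twoAdicModel A))).symm (c m) ∈
                kernel (Valued.v (R := PadicAlgCl 2)) (genFibΩ 2 ((integralModelInt A).map (Int.castRingHom ℤ_[2]))) ∧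
              ptLogΩ 2 ((integralModelInt A).map (Int.castRingHom ℤ_[2]))
                ((toLoc ((genFibΩ_eq_baseChange ((integralModelInt A).map (Int.castRingHom ℤ_[2]))).trans
                  (baseChange_twoAdicModel A))).symm (c m)) = ell 2 m) →
          (∀ m, ∀ τ ∈ stab 2 m, τ • c m = c m) →
          (∀ m, 1 ≤ m → σ m • zeta 2 m = (zeta 2 m)⁻¹) →
          (∀ n, d₀ n = 3 • (c (n + 2) + σ (n + 2) • c (n + 2)) - 2 • c 1) →
          (∀ m, d₀ m ∈ localLayerPointsOfEmb κ ι A m) →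
          (∀ m, d m = WeierstrassCurve.Affine.Point.map (W' := A)
            (Φ : AlgebraicClosure ℚ_[2] →ₐ[ℚ] AlgebraicClosure (v.adicCompletion ℚ))
            (show (A.baseChange (AlgebraicClosure ℚ_[2])).toAffine.Point from d₀ m)) →
          (∀ m, d m ∈ localLayerPointsOfEmb κ (closureEmb (K := ℚ) (v.adicCompletion ℚ)) A m) →
          (∀ m, localTraceOfEmb κ (closureEmb (K := ℚ) (v.adicCompletion ℚ)) A (m + 1) (m + 2) (d (m + 2)) = -d m) →
          (∀ m : ℕ, 1 ≤ m → ∀ P ∈ localLayerPointsOfEmb κ (closureEmb (K := ℚ) (v.adicCompletion ℚ)) A m,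
            ∃ B ∈ AddSubgroup.closure (Set.range fun τ : Field.absoluteGaloisGroup (v.adicCompletion ℚ) ↦ τ • d m),
              ∃ P' ∈ localLayerPointsOfEmb κ (closureEmb (K := ℚ) (v.adicCompletion ℚ)) A (m - 1),
              ∃ R ∈ localLayerPointsOfEmb κ (closureEmb (K := ℚ) (v.adicCompletion ℚ)) A m, P = B + P' + 2 • R) →
          (∀ P ∈ localLayerPointsOfEmb κ (closureEmb (K := ℚ) (v.adicCompletion ℚ)) A 0,
            ∃ a : ℤ, ∃ R ∈ localLayerPointsOfEmb κ (closureEmb (K := ℚ) (v.adicCompletion ℚ)) A 0, P = a • d 0 + 2 • R) →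
        ∀ (g₀ : Field.absoluteGaloisGroup ℚ_[2]) (g : Field.absoluteGaloisGroup (v.adicCompletion ℚ)),
          g = transportAut Φ.toRingEquiv g₀ (SignedEC.modelFix Φ φ hΦφ g₀) →
          κ.IsTopGenerator (resGalOfEmb ι g₀) →
          κ.IsTopGenerator (resGalOfEmb (closureEmb (K := ℚ) (v.adicCompletion ℚ)) g) →
          ((GaloisRep.cyclotomicCharacter ℚ_[2] 2 g₀ : ℤ_[2]ˣ) : ℤ_[2]) = 5 →
          ((GaloisRep.cyclotomicCharacter (v.adicCompletion ℚ) 2 g : ℤ_[2]ˣ) : ℤ_[2]) = 5 →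
          (∀ m j : ℕ, g₀ ^ j • zeta 2 m = zeta 2 m ^ 5 ^ j) →
          (∀ (k j : ℕ) (t : AlgebraicClosure (v.adicCompletion ℚ)), t ^ 2 ^ k = 1 → g ^ j • t = t ^ 5 ^ j) →
          (∀ (W : WeierstrassCurve ℚ) (j : ℕ) (P : localPoints W ℚ_[2]),
            (show localPoints W (v.adicCompletion ℚ) from
              WeierstrassCurve.Affine.Point.map (W' := W)
                (Φ : AlgebraicClosure ℚ_[2] →ₐ[ℚ] AlgebraicClosure (v.adicCompletion ℚ))
                (show (W.baseChange (AlgebraicClosure ℚ_[2])).toAffine.Point from (g₀ ^ j • P))) =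
              g ^ j • (show localPoints W (v.adicCompletion ℚ) from
                WeierstrassCurve.Affine.Point.map (W' := W)
                  (Φ : AlgebraicClosure ℚ_[2] →ₐ[ℚ] AlgebraicClosure (v.adicCompletion ℚ))
                  (show (W.baseChange (AlgebraicClosure ℚ_[2])).toAffine.Point from P))) →
        ∃ s : I.H,
          (∃ μ ν : IwasawaAlgebra 2, μ ∉ 𝔭'.asIdeal ∧ ν ∉ 𝔭'.asIdeal ∧
            ∀ (n : ℕ) (χ : DirichletCharacter ℂ_[2] (2 ^ (n + cyclotomicExponent 2))),
              χ.Even → (∃ j : ℕ, orderOf χ = 2 ^ j) → (χ.IsPrimitive ∨ n ≤ 1) →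
              (∑' k, ((algebraMap ℚ_[2] ℂ_[2]).comp (algebraMap ℤ_[2] ℚ_[2])) (PowerSeries.coeff k ν) *
                  (χ (cyclotomicGenerator 2 : ZMod (2 ^ (n + cyclotomicExponent 2))) - 1) ^ k) *
                (∑' k, ((algebraMap ℚ_[2] ℂ_[2]).comp (algebraMap ℤ_[2] ℚ_[2]))
                    (PowerSeries.coeff k (pairingSum A (localLayerPointsOfEmb κ (closureEmb (K := ℚ) (v.adicCompletion ℚ)) A n)
                      g n (d n) (pair n (I.proj n s)))) *
                  (χ (cyclotomicGenerator 2 : ZMod (2 ^ (n + cyclotomicExponent 2))) - 1) ^ k) =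
              (∑' k, ((algebraMap ℚ_[2] ℂ_[2]).comp (algebraMap ℤ_[2] ℚ_[2])) (PowerSeries.coeff k μ) *
                  (χ (cyclotomicGenerator 2 : ZMod (2 ^ (n + cyclotomicExponent 2))) - 1) ^ k) *
                ratTwistedSymbolSum f χ) ∧
          Nonempty (KatoDescent.KSideDatum I Y s 𝔭')) :
    Summit.BirchSwinnertonDyer.BirchSwinnertonDyer.Theses.ThetaPartnerAtTwo.KatoZetaErlKSideCMAtTwoSupply := by
  refine katoZetaErlKSideCMAtTwoSupply_of_charValuesKSideOnDisplayedHonda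
    fun v hv A _ _ hcm hr hss ha h2 κ γ hκ hγ hcv _ f hf ϖ hϖ Lplus Lminus hPP _ Y 𝔭' h𝔭' hp𝔭' I pair hP1 hP2 hP3 Φ φ hΦφ ι hι
      c σ d₀ d hcΩ hcstab hσ hd₀ hd₀L hdT hL hTR hGEN hGEN0 g₀ g hgdef hgen₀ hgen hχ₀ hχ hζpow hroots hTg ↦ ?_
  obtain ⟨s, ⟨μ, ν, hμ, hν, hval⟩, hK⟩ :=
    hXχp v hv A hcm hr hss ha h2 κ γ hκ hγ hcv f hf ϖ hϖ Lplus Lminus hPP Y 𝔭' h𝔭' hp𝔭' I pair hP1 hP2 hP3 Φ φ hΦφ ι hι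
      c σ d₀ d hcΩ hcstab hσ hd₀ hd₀L hdT hL hTR hGEN hGEN0 g₀ g hgdef hgen₀ hgen hχ₀ hχ hζpow hroots hTg
  refine ⟨s, ⟨μ, ν, hμ, hν, ?_⟩, hK⟩
  -- newform bookkeeping for the three-term relation
  have hf0 : IsNewform0 f := hf.1
  have hQ : coeffField f = ⊥ := hf.coeffField_eq_bot
  have hpN : ¬ 2 ∣ A.conductorNorm ℤ := not_dvd_level_of_isNewformOf hf hss.1
  have hap : cuspCoeff f 2 = ((0 : ℤ) : ℂ) := by
    rw [cuspCoeff_eq_frobeniusTrace_of_isNewformOf_holds hf hss.1, ha]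
  set ιZ : ℤ_[2] →+* ℂ_[2] := (algebraMap ℚ_[2] ℂ_[2]).comp (algebraMap ℤ_[2] ℚ_[2]) with hιZ
  -- the layer functionals agree on lower layers: (P1) + norm compatibility of `s`, twice
  have hcompat : ∀ (m j : ℕ),
      ιZ (evalOn A (localLayerPointsOfEmb κ (closureEmb (K := ℚ) (v.adicCompletion ℚ)) A (m + 2)) (pair (m + 2) (I.proj (m + 2) s))
          (g ^ j • d m)) =
        ιZ (evalOn A (localLayerPointsOfEmb κ (closureEmb (K := ℚ) (v.adicCompletion ℚ)) A m) (pair m (I.proj m s)) (g ^ j • d m)) := by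
    intro m j
    have hj : g ^ j • d m ∈ localLayerPointsOfEmb κ (closureEmb (K := ℚ) (v.adicCompletion ℚ)) A m :=
      smul_mem_localLayerPointsOfEmb κ (closureEmb (K := ℚ) (v.adicCompletion ℚ)) A m (g ^ j) (hL m)
    have hj1 : g ^ j • d m ∈ localLayerPointsOfEmb κ (closureEmb (K := ℚ) (v.adicCompletion ℚ)) A (m + 1) :=
      localLayerPointsOfEmb_mono κ (closureEmb (K := ℚ) (v.adicCompletion ℚ)) A (Nat.le_succ m) hj
    have hj2 : g ^ j • d m ∈ localLayerPointsOfEmb κ (closureEmb (K := ℚ) (v.adicCompletion ℚ)) A (m + 2) :=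
      localLayerPointsOfEmb_mono κ (closureEmb (K := ℚ) (v.adicCompletion ℚ)) A (Nat.le_succ (m + 1)) hj1
    rw [evalOn_of_mem A _ _ hj2, evalOn_of_mem A _ _ hj, ← I.cores_proj m s, hP1 m (I.proj (m + 1) s) (g ^ j • d m) hj,
      ← I.cores_proj (m + 1) s, hP1 (m + 1) (I.proj (m + 2) s) (g ^ j • d m) hj1]
  intro n
  induction n using Nat.strong_induction_on with
  | _ n ih =>
  intro χ hev hord
  by_cases hbase : χ.IsPrimitive ∨ n ≤ 1
  · exact hval n χ hev hord hbase
  have hnp : ¬ χ.IsPrimitive := fun h ↦ hbase (Or.inl h)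
  have hn : ¬ n ≤ 1 := fun h ↦ hbase (Or.inr h)
  obtain ⟨m, rfl⟩ : ∃ m, n = m + 2 := ⟨n - 2, by omega⟩
  set ζ : ℂ_[2] := χ (cyclotomicGenerator 2 : ZMod (2 ^ (m + 2 + cyclotomicExponent 2))) with hζdef
  have hζ1 : ζ ^ 2 ^ (m + 1) = 1 := SignedKatoOffTwo.CoreChi.apply_cyclotomicGenerator_pow_eq_one_of_not_isPrimitive m χ hnp
  -- P-side on the layer-(m+2) functional, then moved to the layer-m functional on the orbit of d_m
  have hP := SignedKatoOffTwo.CoreChi.sum_evalOn_pow_smul_add_two_eq_of_mem κ (closureEmb (K := ℚ) (v.adicCompletion ℚ)) A ιZ hgen hL m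
    (hTR m) (localLayerPointsOfEmb κ (closureEmb (K := ℚ) (v.adicCompletion ℚ)) A (m + 2))
    (fun j ↦ smul_mem_localLayerPointsOfEmb κ (closureEmb (K := ℚ) (v.adicCompletion ℚ)) A (m + 2) (g ^ j) (hL (m + 2)))
    (fun j ↦ localLayerPointsOfEmb_mono κ (closureEmb (K := ℚ) (v.adicCompletion ℚ)) A (show m ≤ m + 2 by omega)
      (smul_mem_localLayerPointsOfEmb κ (closureEmb (K := ℚ) (v.adicCompletion ℚ)) A m (g ^ j) (hL m)))
    (pair (m + 2) (I.proj (m + 2) s)) hζ1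
  simp_rw [hcompat m] at hP
  have hθ := SignedKatoOffTwo.CoreChi.eval₂_mazurTateElement_add_two_eq hf0 hQ hpN hap m hζ1
  have hB := eval₂_mazurTateElement_eq_ratTwistedSymbolSum f χ hev hord
  rw [← hζdef] at hB
  rw [SignedKatoOffTwo.CoreChi.tsum_coeff_pairingSum_mul_pow_eq_sum, hP, ← hB, hθ]
  by_cases hA : ζ ^ 2 ^ m = 1
  · obtain ⟨χ', hev', hord', hχ'⟩ := SignedKatoOffTwo.CoreChi.exists_even_char_apply_cyclotomicGenerator_eq m hA
    have hIH := ih m (by omega) χ' hev' hord'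
    have hB' := eval₂_mazurTateElement_eq_ratTwistedSymbolSum f χ' hev' hord'
    rw [hχ'] at hIH hB'
    rw [SignedKatoOffTwo.CoreChi.tsum_coeff_pairingSum_mul_pow_eq_sum, ← hB'] at hIH
    linear_combination (-(∑ i ∈ Finset.range 2, ζ ^ (2 ^ m * i))) * hIH
  · have hsq : (ζ ^ 2 ^ m) ^ 2 = 1 := by rw [← pow_mul, ← pow_succ, hζ1]
    have hneg : ζ ^ 2 ^ m = -1 := (sq_eq_one_iff.mp hsq).resolve_left hA
    have hS : ∑ i ∈ Finset.range 2, ζ ^ (2 ^ m * i) = 0 := by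
      rw [Finset.sum_range_succ, Finset.sum_range_succ, Finset.sum_range_zero, zero_add, mul_zero, pow_zero, mul_one, hneg]
      ring
    rw [hS]
    ring

end Summit.BirchSwinnertonDyer.BirchSwinnertonDyer.Theorems.KatoZetaErlKSideCMAtTwo

end
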